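import Literature.MathematicalPhysics.QuantumLattice.SectorisedKernelNorm
import Literature.MathematicalPhysics.QuantumLattice.SymmetricRegimeFunctionals
import HarnessLib

/-!
# Extraction: the sectorised `L¹–L^∞` norm dominates the momentum-space vertex functions

Topic `Literature/MathematicalPhysics/QuantumLattice`; follow-up of `SectorisedKernelNorm.lean`
(definition request `defn-SectorisedKernelNorm`, p136784), discharging the part of its design target
(T3) that the module docstring there FLAGS: "the domination of the momentum-space values `vertexFn` /
`selfEnergy` / `cooperAmplitude` of `SymmetricRegimeFunctionals` … by Fourier inversion on
`Fin (2M) × (ℤ/Lℤ)²` … needs the character orthogonality on the space-time lattice, not done here".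
Everything below is PROVED; no new definitions.

* `cexp_sum_latticeMomentum_mul_eq_torusChar` — the spatial factor of `hubbardPlaneWave` is a character
  of the dual torus, `e^{i p_{k⃗}·x⃗} = χ_{k⃗}(x⃗)`; `hubbardPlaneWave_eq` (time phase × character);
* `sum_range_cexp_two_pi_mul` — the roots-of-unity sum `Σ_{j<N} e^{2πi z j/N} = 0` for `N ∤ z`;
  `sum_imagTime_cexp` — **orthogonality in imaginary time**: for kept Matsubara labels `n, n'`,
  `Σ_{j < 2M} e^{-is(ω_{n'} - ω_n) jβ/(2M)} = 2M [n' = n]` (`ω_{n'} - ω_n = 2π(n' - n)/β`, `|n' - n| < 2M`);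
* **`sum_hubbardPlaneWave_mul_conj`** — orthogonality of the plane waves on the space-time lattice
  `Fin (2M) × (ℤ/Lℤ)²`: `Σ_x e^{-is_c k'·x} conj(e^{-is_c k·x}) = |Λ| [k' = k]`, `|Λ| = 2M L²`
  (Salmhofer 1999, App. B.5.5; BGM 2006, (2.4)–(2.5));
* **`sum_sectorisedKernel_mul_conj_prod`** — **Fourier inversion of the sectorised kernels**:
  `Σ_{x} W_{m,Ω}(x) conj(∏_i e^{-is_{c_i}k_i·x_i}) = |Λ|^m (∏_i F_{ω_i}(k_i)) F_m((k_i, σ_i, c_i)_i)`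
  (`sum_prod_apply_eq_prod_sum` factorises the position sum over the legs); hence
  `card_pow_mul_norm_kernel_le_sum_norm_sectorisedKernel` (`|Λ|^m ‖∏F‖ ‖F_m‖ ≤ Σ_x ‖W_{m,Ω}(x)‖`),
  `imagTimeWeight_pow_mul_sum_norm_le` (`ε_x^m Σ_x ‖W_{m+1,Ω}(x)‖ ≤ |Λ| ‖W_{m+1}‖_A` for `Ω ∈ A`) and
  **`pow_mul_norm_prod_mul_norm_kernel_le`** (`(βL²)^m ‖∏F‖ ‖F_{m+1}‖ ≤ ‖W_{m+1}‖_A`, using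
  `ε_x |Λ| = βL²`);
* **`prod_mul_norm_vertexFn_le`** — for an ADMISSIBLE label tuple `Ω ∈ A`,
  `‖∏_i F_{ω_i}(k_i)‖ · ‖𝒱_{m+1}(X)‖ ≤ (m+1)! · ‖W_{m+1}‖_A` where `𝒱 = vertexFn L M β G` is the
  momentum-space vertex function of `SymmetricRegimeFunctionals` (`𝒱_m = m! ε^{1-m} F_m`, `ε = (βL²)⁻¹`)
  and `‖W_{m+1}‖_A = hubbardSectorKernelNorm L M β F A G` — the position-space sectorised `L¹–L^∞`
  norm controls every momentum-space coefficient whose legs sit where the multipliers do not vanish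
  (the factor `(m+1)!` is the antisymmetrisation count carried by `vertexFn`, cf. the degree-growth
  discussion in `SectorisedKernelNorm.lean`); `_bgmSectorSet` — for BGM's constraint set the
  admissibility hypothesis is just spatial momentum conservation of the label string;
* the named instances: **`norm_selfEnergy_le`** (`‖F_ω(K) F_{ω'}(K)‖ ‖Σ(K,σ)‖ ≤ 2 ‖W₂‖`),
  **`norm_cooperAmplitude_le`** (`‖F F F F‖ ‖𝒞(k⃗,k⃗')‖ ≤ 24 ‖W₄‖`), and the degree-`0` identities
  `sectorisedKernel_zero_degree`, **`hubbardSectorKernelNorm_zero_degree`** (`‖W₀‖ = ‖constPart G‖` on the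
  full constraint set; `bgmSectorSet F 0 = univ`).

## Sources

G. Benfatto, A. Giuliani, V. Mastropietro, Ann. Henri Poincaré 7 (2006) 809 = arXiv:cond-mat/0507686,
§2.1 (2.4)–(2.5) (the fields `ψ^±_x = (βL²)⁻¹ Σ_k e^{±ik·x} ψ̂^±_k` and their inversion), §2.7 (2.70)–(2.71a),
§2.8 (2.76) [`BenfattoGiulianiMastropietro2006`]; M. Salmhofer, *Renormalization* (1999), §4.2.4
(4.55)–(4.63) (the discrete time lattice dual to the `2M` Matsubara frequencies) and App. B.5.5
(orthogonality relations) [`Salmhofer1999`]; M. Salmhofer, Commun. Math. Phys. 194 (1998) 249, §5.1,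
§5.3 (momentum-space coefficient functions and their sup norms) [`Salmhofer1998`].  All statements are
routine consequences ("folklore") of finite Fourier inversion.
-/

noncomputable section

namespace Literature.MathematicalPhysics.QuantumLattice

open Finset Literature.Probability.LatticeModels GrassmannAlgebra

variable {L M : ℕ} [NeZero L]

/-! ### The plane waves: spatial characters and time phases -/

/-- **The spatial factor of a plane wave is a character of the dual torus**:
`exp(i Σ_i p_{k⃗,i} x_i) = χ_{k⃗}(x⃗)` with `p_{k⃗} = 2πk⃗/L` read on representatives. [folklore] -/
theorem cexp_sum_latticeMomentum_mul_eq_torusChar (k x : TorusSite 2 L) :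
    Complex.exp (((∑ i, latticeMomentum L k i * ((x i).val : ℝ) : ℝ) : ℂ) * Complex.I) = torusChar k x := by
  have h := torusChar_proj k (fun i => ((x i).val : ℤ))
  have hp : Torus.proj L (fun i => ((x i).val : ℤ)) = x := by
    funext i
    simp [Torus.proj_apply]
  rw [hp] at h
  rw [h]
  congr 1
  push_cast
  ring

/-- The plane wave factorises into a time phase and (the conjugate of) a spatial character:
`e^{-is_c k·x} = e^{-is_c ω_n t_{x₀}} · χ_{k⃗}(x⃗)^{-s_c}`. [folklore] -/
theorem hubbardPlaneWave_eq (β : ℝ) (c : Fin 2) (k : FreqMomentum L M) (x : SpaceTimeIdx L M) :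
    hubbardPlaneWave L M β c k x =
      Complex.exp (-((chargeSign c * (matsubaraFreq β M k.1 * imagTime β M x.1) : ℝ) : ℂ) * Complex.I) *
        (if c = 0 then (starRingEnd ℂ) (torusChar k.2 x.2) else torusChar k.2 x.2) := by
  rw [hubbardPlaneWave, spaceTimePhase, mul_add, Complex.ofReal_add, neg_add, add_mul, Complex.exp_add]
  congr 1
  rw [← cexp_sum_latticeMomentum_mul_eq_torusChar]
  unfold chargeSign
  split_ifs with hc
  · rw [← Complex.exp_conj, map_mul, Complex.conj_ofReal, Complex.conj_I]
    congr 1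
    push_cast
    ring
  · congr 1
    push_cast
    ring

/-- The time phase difference of two kept Matsubara frequencies at the lattice time `jβ/(2M)`:
`(ω_{n'} - ω_n) · jβ/(2M) = 2π (n' - n) j / (2M)` (`β ≠ 0`). [folklore] -/
theorem matsubaraFreq_sub_mul_imagTime {β : ℝ} (hβ : β ≠ 0) (n n' : MatsubaraIdx M) (j : ImagTimeIdx M) :
    (matsubaraFreq β M n' - matsubaraFreq β M n) * imagTime β M j =
      2 * Real.pi * ((matsubaraInt M n' - matsubaraInt M n : ℤ) : ℝ) * (j : ℝ) / (2 * M) := by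
  have hM : (M : ℝ) ≠ 0 := by
    have h := j.pos
    exact_mod_cast (Nat.pos_of_mul_pos_left h).ne'
  simp only [matsubaraFreq, imagTime]
  push_cast
  field_simp
  ring

/-- **Roots of unity sum to zero**: `Σ_{j < N} exp(2πi z j / N) = 0` for an integer `z` not divisible by
`N > 0`. [folklore] -/
theorem sum_range_cexp_two_pi_mul {N : ℕ} (hN : 0 < N) {z : ℤ} (hz : ¬ ((N : ℤ) ∣ z)) :
    ∑ j ∈ range N, Complex.exp (2 * Real.pi * Complex.I * (z : ℂ) / (N : ℂ) * (j : ℂ)) = 0 := by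
  set ζ : ℂ := Complex.exp (2 * Real.pi * Complex.I * (z : ℂ) / (N : ℂ)) with hζ
  have hterm : ∀ j : ℕ, Complex.exp (2 * Real.pi * Complex.I * (z : ℂ) / (N : ℂ) * (j : ℂ)) = ζ ^ j := by
    intro j
    rw [hζ, ← Complex.exp_nat_mul, mul_comm]
  simp_rw [hterm]
  have hNc : (N : ℂ) ≠ 0 := by exact_mod_cast hN.ne'
  have hpow : ζ ^ N = 1 := by
    rw [hζ, ← Complex.exp_nat_mul, Complex.exp_eq_one_iff]
    exact ⟨z, by field_simp⟩
  have hne : ζ ≠ 1 := by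
    intro h1
    rw [hζ, Complex.exp_eq_one_iff] at h1
    obtain ⟨q, hq⟩ := h1
    apply hz
    refine ⟨q, ?_⟩
    have h2 : (z : ℂ) = (q : ℂ) * (N : ℂ) := by
      have hπ : (2 * Real.pi * Complex.I : ℂ) ≠ 0 := by simp [Real.pi_ne_zero, Complex.I_ne_zero]
      field_simp at hq
      linear_combination hq
    have h3 : (z : ℂ) = ((N * q : ℤ) : ℂ) := by rw [h2]; push_cast; ring
    exact_mod_cast h3
  rw [geom_sum_eq hne, hpow, sub_self, zero_div]

/-- **Orthogonality in imaginary time**: for kept Matsubara labels `n, n'` and the sign `s_c = ±1`,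
`Σ_{j < 2M} exp(-i s_c (ω_{n'} - ω_n) jβ/(2M)) = 2M` if `n' = n` and `0` otherwise — the `2M`-th roots of
unity `e^{∓2πi(n'-n)j/(2M)}` sum to zero because `0 < |n' - n| < 2M` (Salmhofer 1999, App. B.5.5). [cite: Salmhofer1999, App. B.5.5] -/
theorem sum_imagTime_cexp {β : ℝ} (hβ : β ≠ 0) (c : Fin 2) (n n' : MatsubaraIdx M) :
    ∑ j : ImagTimeIdx M, Complex.exp (-((chargeSign c * ((matsubaraFreq β M n' - matsubaraFreq β M n) *
        imagTime β M j) : ℝ) : ℂ) * Complex.I) = if n' = n then ((2 * M : ℕ) : ℂ) else 0 := by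
  have hMpos : 0 < 2 * M := n.pos
  -- the integer in the exponent: `z = -s_c (n' - n)`
  set d : ℤ := matsubaraInt M n' - matsubaraInt M n with hd
  set z : ℤ := if c = 0 then -d else d with hz
  have hcs : (-(chargeSign c) * (d : ℝ) : ℝ) = (z : ℝ) := by
    rw [hz]; unfold chargeSign; split_ifs <;> push_cast <;> ring
  have hterm : ∀ j : ImagTimeIdx M, Complex.exp (-((chargeSign c * ((matsubaraFreq β M n' - matsubaraFreq β M n) *
      imagTime β M j) : ℝ) : ℂ) * Complex.I) =
      Complex.exp (2 * Real.pi * Complex.I * (z : ℂ) / ((2 * M : ℕ) : ℂ) * ((j : ℕ) : ℂ)) := by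
    intro j
    rw [matsubaraFreq_sub_mul_imagTime hβ]
    congr 1
    have : (-(chargeSign c * (2 * Real.pi * ((d : ℤ) : ℝ) * (j : ℝ) / (2 * M))) : ℝ) =
        2 * Real.pi * (z : ℝ) / (2 * M) * (j : ℝ) := by
      rw [← hcs]; ring
    rw [← Complex.ofReal_neg, this]
    push_cast
    ring
  simp_rw [hterm]
  rw [Fin.sum_univ_eq_sum_range (fun j => Complex.exp (2 * Real.pi * Complex.I * (z : ℂ) / ((2 * M : ℕ) : ℂ) * (j : ℂ)))
    (2 * M)]
  by_cases hnn : n' = n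
  · subst hnn
    have hz0 : z = 0 := by rw [hz, hd, sub_self]; simp
    simp [hz0]
  · rw [if_neg hnn]
    have hd0 : d ≠ 0 := by
      intro h0
      apply hnn
      rw [hd, sub_eq_zero, matsubaraInt, matsubaraInt] at h0
      exact Fin.ext (by exact_mod_cast (sub_left_inj.1 h0))
    have hdlt : |d| < 2 * M := by
      have h1 := n.isLt
      have h2 := n'.isLt
      rw [hd, matsubaraInt, matsubaraInt, abs_lt]
      constructor <;> omega
    refine sum_range_cexp_two_pi_mul hMpos fun ⟨q, hq⟩ => ?_
    have hzabs : |z| = |d| := by rw [hz]; split_ifs <;> simp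
    have hz0 : z ≠ 0 := by rw [hz]; split_ifs <;> simp [hd0]
    -- `z = 2M q` with `0 < |z| < 2M` is impossible
    rcases eq_or_ne q 0 with hq0 | hq0
    · exact hz0 (by rw [hq, hq0, mul_zero])
    · have h1 : ((2 * M : ℕ) : ℤ) ≤ |z| := by
        rw [hq, abs_mul, Nat.abs_cast]
        have := Int.one_le_abs hq0
        have h0 : (0 : ℤ) ≤ ((2 * M : ℕ) : ℤ) := by positivity
        nlinarith
      rw [hzabs] at h1
      push_cast at h1
      exact absurd hdlt (not_lt.2 h1)

/-- **Orthogonality of the plane waves on the space-time lattice** `Λ = Fin (2M) × (ℤ/Lℤ)²`: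
`Σ_{x ∈ Λ} e^{-is_c k'·x} conj(e^{-is_c k·x}) = |Λ| [k' = k]` — the time phases are orthogonal by
`sum_imagTime_cexp`, the spatial characters by `sum_torusChar_right` (Salmhofer 1999, App. B.5.5;
BGM 2006, (2.4)–(2.5): the inversion of `ψ^±_x = (βL²)⁻¹ Σ_k e^{±ik·x} ψ̂^±_k`). [cite: Salmhofer1999, App. B.5.5] -/
theorem sum_hubbardPlaneWave_mul_conj {β : ℝ} (hβ : β ≠ 0) (c : Fin 2) (k k' : FreqMomentum L M) :
    ∑ x : SpaceTimeIdx L M, hubbardPlaneWave L M β c k' x * (starRingEnd ℂ) (hubbardPlaneWave L M β c k x) =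
      if k' = k then (Fintype.card (SpaceTimeIdx L M) : ℂ) else 0 := by
  -- factorise each summand into a time phase and a spatial character of `k' - k`
  have hfac : ∀ x : SpaceTimeIdx L M,
      hubbardPlaneWave L M β c k' x * (starRingEnd ℂ) (hubbardPlaneWave L M β c k x) =
        Complex.exp (-((chargeSign c * ((matsubaraFreq β M k'.1 - matsubaraFreq β M k.1) * imagTime β M x.1) : ℝ) : ℂ) *
            Complex.I) *
          (if c = 0 then (starRingEnd ℂ) (torusChar (k'.2 - k.2) x.2) else torusChar (k'.2 - k.2) x.2) := by
    intro x
    rw [hubbardPlaneWave_eq, hubbardPlaneWave_eq, map_mul, ← Complex.exp_conj, map_mul, Complex.conj_I,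
      map_neg, Complex.conj_ofReal]
    have htime : Complex.exp (-((chargeSign c * (matsubaraFreq β M k'.1 * imagTime β M x.1) : ℝ) : ℂ) * Complex.I) *
        Complex.exp (-((chargeSign c * (matsubaraFreq β M k.1 * imagTime β M x.1) : ℝ) : ℂ) * -Complex.I) =
        Complex.exp (-((chargeSign c * ((matsubaraFreq β M k'.1 - matsubaraFreq β M k.1) * imagTime β M x.1) : ℝ) : ℂ) *
          Complex.I) := by
      rw [← Complex.exp_add]
      congr 1
      push_cast
      ring
    split_ifs with hc
    · rw [Complex.conj_conj, mul_mul_mul_comm, htime, torusChar_sub_left, map_mul, Complex.conj_conj]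
    · rw [mul_mul_mul_comm, htime, torusChar_sub_left]
  simp_rw [hfac]
  rw [Fintype.sum_prod_type]
  simp_rw [← Finset.mul_sum]
  rw [← Finset.sum_mul, sum_imagTime_cexp hβ c k.1 k'.1]
  -- the spatial sum
  have hspace : (∑ y : TorusSite 2 L, if c = 0 then (starRingEnd ℂ) (torusChar (k'.2 - k.2) y) else torusChar (k'.2 - k.2) y) =
      if k'.2 = k.2 then ((L : ℂ) ^ 2) else 0 := by
    have hsum := sum_torusChar_right (d := 2) (L := L) (k'.2 - k.2)
    by_cases hc : c = 0
    · simp_rw [if_pos hc]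
      rw [← map_sum, hsum]
      by_cases h2 : k'.2 = k.2
      · rw [if_pos (sub_eq_zero.2 h2), if_pos h2, map_pow, Complex.conj_natCast]
      · rw [if_neg (fun h => h2 (sub_eq_zero.1 h)), if_neg h2, map_zero]
    · simp_rw [if_neg hc]
      rw [hsum]
      by_cases h2 : k'.2 = k.2
      · rw [if_pos (sub_eq_zero.2 h2), if_pos h2]
      · rw [if_neg (fun h => h2 (sub_eq_zero.1 h)), if_neg h2]
  rw [hspace]
  by_cases h1 : k'.1 = k.1 <;> by_cases h2 : k'.2 = k.2
  · rw [if_pos h1, if_pos h2, if_pos (Prod.ext h1 h2), Fintype.card_prod, Fintype.card_fin, Fintype.card_pi,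
      Fin.prod_const, ZMod.card]
    push_cast
    ring
  · rw [if_neg h2, mul_zero, if_neg (fun h => h2 (congrArg Prod.snd h))]
  · rw [if_neg h1, zero_mul, if_neg (fun h => h1 (congrArg Prod.fst h))]
  · rw [if_neg h1, zero_mul, if_neg (fun h => h1 (congrArg Prod.fst h))]

/-! ### Fourier inversion of the sectorised kernels -/

/-- Summing a product of one-leg functions over all position tuples factorises over the legs. [folklore] -/
theorem sum_prod_apply_eq_prod_sum {α R : Type*} [Fintype α] [CommSemiring R] {m : ℕ} (f : Fin m → α → R) :
    ∑ x : Fin m → α, ∏ i, f i (x i) = ∏ i, ∑ y, f i y := by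
  classical
  rw [Finset.prod_univ_sum]
  simp only [Fintype.piFinset_univ]

/-- **Fourier inversion of the sectorised kernels** (BGM 2006, (2.70) read backwards; Salmhofer 1999,
App. B.5.5): testing the degree-`m` sectorised position-space kernel of `G` against the conjugate plane
waves of the momenta `k₁,…,k_m` returns `|Λ|^m (∏_i F_{ω_i}(k_i)) F_m((k_i, σ_i, c_i)_i)`, the momentum
kernel of `G` (`kernel ℂ G m`, `GrassmannKernels.lean`) times the multipliers of the legs,
`|Λ| = 2M L²` the number of space-time points. [cite: BenfattoGiulianiMastropietro2006, §2.7 (2.70)] -/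
theorem sum_sectorisedKernel_mul_conj_prod {N : ℕ} {β : ℝ} (hβ : β ≠ 0) (F : Fin N → FreqMomentum L M → ℂ)
    (G : HubbardGrassmann L M) (m : ℕ) (Ω : Fin m → SectorLeg N) (k : Fin m → FreqMomentum L M) :
    ∑ x : Fin m → SpaceTimeIdx L M, sectorisedKernel L M β F G m Ω x *
        (starRingEnd ℂ) (∏ i, hubbardPlaneWave L M β (Ω i).2 (k i) (x i)) =
      (Fintype.card (SpaceTimeIdx L M) : ℂ) ^ m * (∏ i, F (Ω i).1.1 (k i)) *
        kernel ℂ G m (fun i => ((k i, (Ω i).1.2), (Ω i).2)) := by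
  set P : ℂ := (Fintype.card (SpaceTimeIdx L M) : ℂ) with hP
  -- expand and exchange the sums
  simp only [sectorisedKernel, sum_mul]
  rw [sum_comm]
  -- for each `k'` the `x`-sum factorises over the legs and is computed by orthogonality
  have hx : ∀ k' : Fin m → FreqMomentum L M,
      ∑ x : Fin m → SpaceTimeIdx L M, (∏ i, F (Ω i).1.1 (k' i) * hubbardPlaneWave L M β (Ω i).2 (k' i) (x i)) *
          kernel ℂ G m (fun i => ((k' i, (Ω i).1.2), (Ω i).2)) *
          (starRingEnd ℂ) (∏ i, hubbardPlaneWave L M β (Ω i).2 (k i) (x i)) =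
        kernel ℂ G m (fun i => ((k' i, (Ω i).1.2), (Ω i).2)) *
          ∏ i, (F (Ω i).1.1 (k' i) * if k' i = k i then P else 0) := by
    intro k'
    have hre : ∀ x : Fin m → SpaceTimeIdx L M,
        (∏ i, F (Ω i).1.1 (k' i) * hubbardPlaneWave L M β (Ω i).2 (k' i) (x i)) *
          kernel ℂ G m (fun i => ((k' i, (Ω i).1.2), (Ω i).2)) *
          (starRingEnd ℂ) (∏ i, hubbardPlaneWave L M β (Ω i).2 (k i) (x i)) =
        kernel ℂ G m (fun i => ((k' i, (Ω i).1.2), (Ω i).2)) *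
          ∏ i, (F (Ω i).1.1 (k' i) * (hubbardPlaneWave L M β (Ω i).2 (k' i) (x i) *
            (starRingEnd ℂ) (hubbardPlaneWave L M β (Ω i).2 (k i) (x i)))) := by
      intro x
      rw [map_prod, mul_right_comm, ← prod_mul_distrib, mul_comm]
      exact congrArg _ (prod_congr rfl fun i _ => mul_assoc _ _ _)
    simp_rw [hre]
    rw [← mul_sum, sum_prod_apply_eq_prod_sum
      (fun i y => F (Ω i).1.1 (k' i) * (hubbardPlaneWave L M β (Ω i).2 (k' i) y *
        (starRingEnd ℂ) (hubbardPlaneWave L M β (Ω i).2 (k i) y)))]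
    congr 1
    refine prod_congr rfl fun i _ => ?_
    rw [← mul_sum, sum_hubbardPlaneWave_mul_conj hβ]
  simp_rw [hx]
  -- the product of the Kronecker deltas
  have hprod : ∀ k' : Fin m → FreqMomentum L M,
      (∏ i, (F (Ω i).1.1 (k' i) * if k' i = k i then P else 0)) =
        if k' = k then P ^ m * ∏ i, F (Ω i).1.1 (k i) else 0 := by
    intro k'
    by_cases hk : k' = k
    · subst hk
      simp only [if_true, prod_mul_distrib, prod_const, card_univ, Fintype.card_fin]
      ring
    · rw [if_neg hk]
      obtain ⟨i, hi⟩ := Function.ne_iff.1 hk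
      exact prod_eq_zero (mem_univ i) (by rw [if_neg hi, mul_zero])
  simp_rw [hprod, mul_ite, mul_zero]
  rw [sum_ite_eq' univ k, if_pos (mem_univ _)]
  ring

/-- The Fourier-inversion bound: `|Λ|^m ‖∏_i F_{ω_i}(k_i)‖ ‖F_m(k,σ,c)‖ ≤ Σ_x ‖W_{m,Ω}(x)‖` (plane waves are
unimodular). [folklore] -/
theorem card_pow_mul_norm_kernel_le_sum_norm_sectorisedKernel {N : ℕ} {β : ℝ} (hβ : β ≠ 0)
    (F : Fin N → FreqMomentum L M → ℂ) (G : HubbardGrassmann L M) (m : ℕ) (Ω : Fin m → SectorLeg N)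
    (k : Fin m → FreqMomentum L M) :
    (Fintype.card (SpaceTimeIdx L M) : ℝ) ^ m * (‖∏ i, F (Ω i).1.1 (k i)‖ *
        ‖kernel ℂ G m (fun i => ((k i, (Ω i).1.2), (Ω i).2))‖) ≤
      ∑ x : Fin m → SpaceTimeIdx L M, ‖sectorisedKernel L M β F G m Ω x‖ := by
  have h := congrArg (fun z : ℂ => ‖z‖) (sum_sectorisedKernel_mul_conj_prod hβ F G m Ω k)
  simp only [norm_mul, norm_pow, Complex.norm_natCast] at h
  rw [← mul_assoc, ← h]
  refine (norm_sum_le _ _).trans (sum_le_sum fun x _ => ?_)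
  rw [norm_mul, map_prod, norm_prod]
  refine mul_le_of_le_one_right (norm_nonneg _) (le_of_eq (prod_eq_one fun i _ => ?_))
  rw [Complex.norm_conj, norm_hubbardPlaneWave]

/-- **The `L¹` mass of an admissible sectorised kernel is controlled by the norm**:
`ε_x^m Σ_x ‖W_{m+1,Ω}(x)‖ ≤ |Λ| · ‖W_{m+1}‖_A` for `Ω ∈ A` (slice the sum by the position of leg `0`; each
slice is a summand of a leg sum). [folklore] -/
theorem imagTimeWeight_pow_mul_sum_norm_le {N : ℕ} {β : ℝ} (hβ : 0 ≤ β) (F : Fin N → FreqMomentum L M → ℂ)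
    (G : HubbardGrassmann L M) {m : ℕ} {A : Finset (Fin (m + 1) → SectorLeg N)} {Ω : Fin (m + 1) → SectorLeg N}
    (hΩ : Ω ∈ A) :
    imagTimeWeight β M ^ m * ∑ x : Fin (m + 1) → SpaceTimeIdx L M, ‖sectorisedKernel L M β F G (m + 1) Ω x‖ ≤
      Fintype.card (SpaceTimeIdx L M) * hubbardSectorKernelNorm L M β F A G := by
  have hε := imagTimeWeight_nonneg hβ M
  rw [← sum_fiberwise_of_maps_to (s := univ) (t := (univ : Finset (SpaceTimeIdx L M))) (g := fun x => x 0)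
    (fun _ _ => mem_univ _), mul_sum]
  have hcard : (Fintype.card (SpaceTimeIdx L M) : ℝ) * hubbardSectorKernelNorm L M β F A G =
      ∑ _x₀ : SpaceTimeIdx L M, hubbardSectorKernelNorm L M β F A G := by
    rw [sum_const, card_univ, nsmul_eq_mul]
  rw [hcard]
  refine sum_le_sum fun x₀ _ => ?_
  refine le_trans ?_ (sectorLegSum_le_sectorisedKernelNorm (imagTimeWeight β M) A (sectorisedKernel L M β F G (m + 1)) 0 (Ω 0) x₀)
  rw [sectorLegSum]
  exact single_le_sum (f := fun Ω' => imagTimeWeight β M ^ m *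
      ∑ X ∈ univ.filter (fun X : Fin (m + 1) → SpaceTimeIdx L M => X 0 = x₀), ‖sectorisedKernel L M β F G (m + 1) Ω' X‖)
    (fun _ _ => mul_nonneg (pow_nonneg hε _) (sum_nonneg fun _ _ => norm_nonneg _)) (mem_filter.2 ⟨hΩ, rfl⟩)

/-- **The sectorised norm dominates the multiplied momentum kernels**: for an admissible label tuple
`Ω ∈ A` and momenta `k`, `(βL²)^m ‖∏_i F_{ω_i}(k_i)‖ ‖F_{m+1}((k_i,σ_i,c_i)_i)‖ ≤ ‖W_{m+1}‖_A` (`0 < β`),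
i.e. `‖∏ F‖ · |F_{m+1}(X)| ≤ ε^m ‖W_{m+1}‖_A` with the momentum weight `ε = (βL²)⁻¹` — the content of
BGM's remark that the sector sums of (2.76) control the kernels of `𝒱^{(h)}` leg by leg. [cite: BenfattoGiulianiMastropietro2006, §2.8 (2.76)] -/
theorem pow_mul_norm_prod_mul_norm_kernel_le {N : ℕ} {β : ℝ} (hβ : 0 < β) (F : Fin N → FreqMomentum L M → ℂ)
    (G : HubbardGrassmann L M) {m : ℕ} {A : Finset (Fin (m + 1) → SectorLeg N)} {Ω : Fin (m + 1) → SectorLeg N}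
    (hΩ : Ω ∈ A) (k : Fin (m + 1) → FreqMomentum L M) :
    (β * (L : ℝ) ^ 2) ^ m * (‖∏ i, F (Ω i).1.1 (k i)‖ * ‖kernel ℂ G (m + 1) (fun i => ((k i, (Ω i).1.2), (Ω i).2))‖) ≤
      hubbardSectorKernelNorm L M β F A G := by
  -- `M ≠ 0`: leg `0` carries one of the `2M` kept frequencies
  have hM : 0 < M := Nat.pos_of_mul_pos_left (k 0).1.pos
  haveI : NeZero M := ⟨hM.ne'⟩
  set P : ℝ := (Fintype.card (SpaceTimeIdx L M) : ℝ) with hP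
  have hPpos : 0 < P := by
    rw [hP]
    exact_mod_cast (Fintype.card_pos_iff.2 ⟨((k 0).1, 0)⟩ : 0 < Fintype.card (SpaceTimeIdx L M))
  have hεP : imagTimeWeight β M * P = β * (L : ℝ) ^ 2 := imagTimeWeight_mul_card β L M
  have h1 := card_pow_mul_norm_kernel_le_sum_norm_sectorisedKernel hβ.ne' F G (m + 1) Ω k
  have h2 := imagTimeWeight_pow_mul_sum_norm_le hβ.le F G hΩ
  rw [← hP] at h1 h2
  -- combine: `ε^m P^{m+1} (…) ≤ ε^m Σ ≤ P ‖W‖`, then cancel `P`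
  have h3 : imagTimeWeight β M ^ m * (P ^ (m + 1) * (‖∏ i, F (Ω i).1.1 (k i)‖ *
      ‖kernel ℂ G (m + 1) (fun i => ((k i, (Ω i).1.2), (Ω i).2))‖)) ≤ P * hubbardSectorKernelNorm L M β F A G :=
    (mul_le_mul_of_nonneg_left h1 (pow_nonneg (imagTimeWeight_nonneg hβ.le M) _)).trans h2
  rw [← hεP, mul_pow]
  refine le_of_mul_le_mul_left ?_ hPpos
  calc P * (imagTimeWeight β M ^ m * P ^ m * (‖∏ i, F (Ω i).1.1 (k i)‖ *
        ‖kernel ℂ G (m + 1) (fun i => ((k i, (Ω i).1.2), (Ω i).2))‖))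
      = imagTimeWeight β M ^ m * (P ^ (m + 1) * (‖∏ i, F (Ω i).1.1 (k i)‖ *
          ‖kernel ℂ G (m + 1) (fun i => ((k i, (Ω i).1.2), (Ω i).2))‖)) := by ring
    _ ≤ P * hubbardSectorKernelNorm L M β F A G := h3

/-! ### Domination of the momentum-space vertex functions of `SymmetricRegimeFunctionals` -/

/-- **Extraction (T3 of the request): the sectorised `L¹–L^∞` norm dominates the momentum-space vertex
functions.**  For an admissible label tuple `Ω ∈ A` and any momenta `k`, the vertex function
`𝒱_{m+1} = (m+1)! ε^{-m} F_{m+1}` (`vertexFn L M β G`, `ε = (βL²)⁻¹`, `SymmetricRegimeFunctionals.lean`) at the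
label string `X_i = ((k_i, σ_i), c_i)` satisfies `‖∏_i F_{ω_i}(k_i)‖ · ‖𝒱_{m+1}(X)‖ ≤ (m+1)! · ‖W_{m+1}‖_A`
(`0 < β`); the factorial is the antisymmetrisation count carried by `vertexFn`. [cite: BenfattoGiulianiMastropietro2006, §2.8 (2.76)] -/
theorem prod_mul_norm_vertexFn_le {N : ℕ} {β : ℝ} (hβ : 0 < β) (F : Fin N → FreqMomentum L M → ℂ)
    (G : HubbardGrassmann L M) {m : ℕ} {A : Finset (Fin (m + 1) → SectorLeg N)} {Ω : Fin (m + 1) → SectorLeg N}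
    (hΩ : Ω ∈ A) (k : Fin (m + 1) → FreqMomentum L M) :
    ‖∏ i, F (Ω i).1.1 (k i)‖ * ‖vertexFn L M β G (m + 1) (fun i => ((k i, (Ω i).1.2), (Ω i).2))‖ ≤
      (m + 1).factorial * hubbardSectorKernelNorm L M β F A G := by
  have h := pow_mul_norm_prod_mul_norm_kernel_le hβ F G hΩ k
  have hfac : (0 : ℝ) ≤ (m + 1).factorial := by positivity
  rw [vertexFn_def, norm_mul, Complex.norm_real, Real.norm_eq_abs, Nat.add_sub_cancel,
    abs_of_nonneg (by positivity : (0 : ℝ) ≤ ((m + 1).factorial : ℝ) * (β * (L : ℝ) ^ 2) ^ m)]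
  calc ‖∏ i, F (Ω i).1.1 (k i)‖ * (((m + 1).factorial : ℝ) * (β * (L : ℝ) ^ 2) ^ m *
        ‖kernel ℂ G (m + 1) (fun i => ((k i, (Ω i).1.2), (Ω i).2))‖)
      = (m + 1).factorial * ((β * (L : ℝ) ^ 2) ^ m * (‖∏ i, F (Ω i).1.1 (k i)‖ *
          ‖kernel ℂ G (m + 1) (fun i => ((k i, (Ω i).1.2), (Ω i).2))‖)) := by ring
    _ ≤ (m + 1).factorial * hubbardSectorKernelNorm L M β F A G := mul_le_mul_of_nonneg_left h hfac

/-- **The same for BGM's constraint set `χ`** (`bgmSectorSet`): there admissibility of `Ω` for the momenta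
`k` is spatial momentum conservation of the label string (if some multiplier vanishes at its momentum the
left-hand side is zero). [cite: BenfattoGiulianiMastropietro2006, §2.8 (2.73)] -/
theorem prod_mul_norm_vertexFn_le_bgmSectorSet {N : ℕ} {β : ℝ} (hβ : 0 < β) (F : Fin N → FreqMomentum L M → ℂ)
    (G : HubbardGrassmann L M) {m : ℕ} (Ω : Fin (m + 1) → SectorLeg N) (k : Fin (m + 1) → FreqMomentum L M)
    (hcons : ∑ i, signedMomentum L (Ω i).2 (k i).2 = 0) :
    ‖∏ i, F (Ω i).1.1 (k i)‖ * ‖vertexFn L M β G (m + 1) (fun i => ((k i, (Ω i).1.2), (Ω i).2))‖ ≤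
      (m + 1).factorial * hubbardSectorKernelNorm L M β F (bgmSectorSet L M F (m + 1)) G := by
  by_cases hF : ∀ i, F (Ω i).1.1 (k i) ≠ 0
  · exact prod_mul_norm_vertexFn_le hβ F G ((mem_bgmSectorSet F Ω).2 ⟨k, hF, hcons⟩) k
  · push Not at hF
    obtain ⟨i, hi⟩ := hF
    rw [prod_eq_zero (mem_univ i) hi, norm_zero, zero_mul]
    exact mul_nonneg (by positivity) (hubbardSectorKernelNorm_nonneg hβ.le _ _ _)

/-- **The self-energy is dominated by the degree-`2` norm**: for every kept frequency–momentum `K`, spin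
`σ` and sectors `ω, ω'`, `‖F_ω(K) F_{ω'}(K)‖ · ‖Σ(K,σ)‖ ≤ 2 ‖W₂‖_χ` (`selfEnergy` of
`SymmetricRegimeFunctionals`: the coefficient `𝒱₂(ψ̂⁺_{Kσ}, ψ̂⁻_{Kσ})`; the pair `(+K⃗, -K⃗)` conserves
momentum, so the tuple is admissible for `χ`). [folklore] -/
theorem norm_selfEnergy_le {N : ℕ} {β : ℝ} (hβ : 0 < β) (F : Fin N → FreqMomentum L M → ℂ)
    (G : HubbardGrassmann L M) (K : FreqMomentum L M) (σ : Fin 2) (ω ω' : Fin N) :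
    ‖F ω K * F ω' K‖ * ‖selfEnergy L M β G K σ‖ ≤ 2 * hubbardSectorKernelNorm L M β F (bgmSectorSet L M F 2) G := by
  have h := prod_mul_norm_vertexFn_le_bgmSectorSet hβ F G (![((ω, σ), 0), ((ω', σ), 1)] : Fin 2 → SectorLeg N)
    ![K, K] (by simp [Fin.sum_univ_two, signedMomentum])
  have hX : (fun i : Fin 2 => (((![K, K] : Fin 2 → FreqMomentum L M) i,
      ((![((ω, σ), 0), ((ω', σ), 1)] : Fin 2 → SectorLeg N) i).1.2), ((![((ω, σ), 0), ((ω', σ), 1)] : Fin 2 → SectorLeg N) i).2))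
      = ![((K, σ), 0), ((K, σ), 1)] := by
    funext i; fin_cases i <;> rfl
  rw [hX, Fin.prod_univ_two] at h
  simpa [selfEnergy, Nat.factorial] using h

/-- **The Cooper amplitude is dominated by the degree-`4` norm**: for torus momenta `k⃗, k⃗'` and sectors
`ω₁,…,ω₄` of the four legs `(ω₀,k⃗')↑⁺, (-ω₀,-k⃗')↓⁺, (-ω₀,-k⃗)↓⁻, (ω₀,k⃗)↑⁻` (`cooperAmplitude` of
`SymmetricRegimeFunctionals`), `‖F F F F‖ · ‖𝒞(k⃗,k⃗')‖ ≤ 24 ‖W₄‖_χ` (the pair-scattering string conserves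
momentum: `k⃗' - k⃗' + k⃗ - k⃗ = 0`). [folklore] -/
theorem norm_cooperAmplitude_le [NeZero M] {N : ℕ} {β : ℝ} (hβ : 0 < β) (F : Fin N → FreqMomentum L M → ℂ)
    (G : HubbardGrassmann L M) (k k' : TorusSite 2 L) (ω₁ ω₂ ω₃ ω₄ : Fin N) :
    ‖F ω₁ (omega0 M, k') * F ω₂ (FreqMomentum.neg (omega0 M, k')) * F ω₃ (FreqMomentum.neg (omega0 M, k)) *
        F ω₄ (omega0 M, k)‖ * ‖cooperAmplitude L M β G k k'‖ ≤
      24 * hubbardSectorKernelNorm L M β F (bgmSectorSet L M F 4) G := by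
  have h := prod_mul_norm_vertexFn_le_bgmSectorSet hβ F G
    (![((ω₁, 0), 0), ((ω₂, 1), 0), ((ω₃, 1), 1), ((ω₄, 0), 1)] : Fin 4 → SectorLeg N)
    ![(omega0 M, k'), FreqMomentum.neg (omega0 M, k'), FreqMomentum.neg (omega0 M, k), (omega0 M, k)]
    (by simp [Fin.sum_univ_four, signedMomentum, FreqMomentum.neg])
  have hX : (fun i : Fin 4 => (((![(omega0 M, k'), FreqMomentum.neg (omega0 M, k'), FreqMomentum.neg (omega0 M, k),
      (omega0 M, k)] : Fin 4 → FreqMomentum L M) i,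
      ((![((ω₁, 0), 0), ((ω₂, 1), 0), ((ω₃, 1), 1), ((ω₄, 0), 1)] : Fin 4 → SectorLeg N) i).1.2),
      ((![((ω₁, 0), 0), ((ω₂, 1), 0), ((ω₃, 1), 1), ((ω₄, 0), 1)] : Fin 4 → SectorLeg N) i).2)) =
      ![(((omega0 M, k'), 0), 0), ((FreqMomentum.neg (omega0 M, k'), 1), 0),
        ((FreqMomentum.neg (omega0 M, k), 1), 1), (((omega0 M, k), 0), 1)] := by
    funext i; fin_cases i <;> rfl
  rw [hX, Fin.prod_univ_four] at h
  simpa [cooperAmplitude, Nat.factorial, mul_assoc] using h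

/-! ### Degree `0`: the constant part -/

/-- In degree `0` the sectorised kernel is the constant part. [folklore] -/
theorem sectorisedKernel_zero_degree {N : ℕ} (β : ℝ) (F : Fin N → FreqMomentum L M → ℂ) (G : HubbardGrassmann L M)
    (Ω : Fin 0 → SectorLeg N) (x : Fin 0 → SpaceTimeIdx L M) :
    sectorisedKernel L M β F G 0 Ω x = constPart ℂ G := by
  simp [sectorisedKernel, kernel_zero]

/-- **BGM's constraint is empty in degree `0`**: `χ = univ` (the empty tuple conserves momentum). [folklore] -/
theorem bgmSectorSet_zero {N : ℕ} (F : Fin N → FreqMomentum L M → ℂ) :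
    bgmSectorSet L M F 0 = (univ : Finset (Fin 0 → SectorLeg N)) := by
  ext Ω
  simp only [mem_bgmSectorSet, mem_univ, iff_true]
  exact ⟨fun i => i.elim0, fun i => i.elim0, by simp⟩

/-- **In degree `0` the sectorised norm over the full constraint set is the modulus of the constant part**
(so `‖constPart G‖` — `βL²` times the free-energy density carried by `G` — is exactly the degree-`0`
entry of the degree-weighted norms `hubbardSectorActionNorm` / `bgmNorm`). [folklore] -/
theorem hubbardSectorKernelNorm_zero_degree {N : ℕ} (β : ℝ) (F : Fin N → FreqMomentum L M → ℂ) (G : HubbardGrassmann L M) :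
    hubbardSectorKernelNorm L M β F (univ : Finset (Fin 0 → SectorLeg N)) G = ‖constPart ℂ G‖ := by
  rw [hubbardSectorKernelNorm_def, sectorisedKernelNorm_zero_left, Fintype.sum_unique, sectorisedKernel_zero_degree]

end Literature.MathematicalPhysics.QuantumLattice
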